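import Literature.NumberTheory.EllipticCurves.ShintaniLiftQExpansion
import HarnessLib

/-!
# The diagonal coefficient of the twisted Shintani lift, I: canonicity of the orbit data

[[cite: Shintani1975, §2, (2.14)–(2.15)]] — the orbit coefficient `coef(ω)` of
`ShintaniLiftQExpansion` is defined through CHOSEN orbit data `(λ, P)`; here we PROVE that it can
be computed from ANY data describing the orbit integrals: `cD_mul_data_eq` (two data with
`λ² = λ'²` and the same `J_z(ω)` have `c_D(k) λ P = c_D(k) λ' P'`) and **`orbCoef_eq_of_data`**
(`coef_D(ω) = 8√D · c_D(k_ω) λ P / √Δ`).  This is the entry point for the explicit evaluation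
of the diagonal (split) orbits by modular symbols (`ShintaniSplitPeriods`).

No named facts, no new definitions.
-/

noncomputable section

open scoped MatrixGroups ModularForm Modular Topology
open UpperHalfPlane hiding I
open Complex Filter MeasureTheory Set CongruenceSubgroup ModularGroup Real MulAction
open Literature.NumberTheory.EllipticCurves.ModularForms

namespace Literature.NumberTheory.EllipticCurves.Shintani

variable (D : ℕ) [NeZero D]

/-- The `z`-dependent factor `e(λ²Z) √(π/(4π Im Z λ²))` is non-zero and depends on `λ` only
through `λ²`. [folklore] -/
theorem zFactor_ne_zero (z : ℍ) {lam : ℝ} (hlam : lam ≠ 0) :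
    cexp (2 * π * I * (lam ^ 2 : ℝ) * (zScaled D z : ℂ)) *
      (Real.sqrt (π / (4 * π * (zScaled D z : ℂ).im * lam ^ 2)) : ℂ) ≠ 0 := by
  refine mul_ne_zero (Complex.exp_ne_zero _) ?_
  have h1 : 0 < (zScaled D z : ℂ).im := by rw [UpperHalfPlane.coe_im]; exact (zScaled D z).im_pos
  have h2 : 0 < lam ^ 2 := by positivity
  exact Complex.ofReal_ne_zero.mpr (Real.sqrt_pos.mpr (by positivity)).ne'

/-- **Canonicity of `c_D(k) λ P`**: two orbit data `(λ, P)`, `(λ', P')` with `λ² = λ'² = Δ`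
describing the same orbit integrals have `c_D(k) λ P = c_D(k) λ' P'`. [folklore] -/
theorem cD_mul_data_eq (z : ℍ) {k : Fin 3 → ℤ} {J : ℂ} {lam lam' : ℝ} {P P' : ℂ}
    (hlam : lam ≠ 0) (hsq : lam ^ 2 = lam' ^ 2)
    (hJ : J = anisoConst D z k lam * P * (Real.sqrt (π / (4 * π * (zScaled D z : ℂ).im * lam ^ 2)) : ℝ))
    (hJ' : J = anisoConst D z k lam' * P' * (Real.sqrt (π / (4 * π * (zScaled D z : ℂ).im * lam' ^ 2)) : ℝ)) :
    cD D k * lam * P = cD D k * lam' * P' := by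
  have hne := zFactor_ne_zero D z hlam
  rw [← hsq] at hJ'
  rw [hJ, anisoConst, anisoConst, hsq] at hJ'
  rw [hsq] at hne
  have : (cD D k * lam * P) * (cexp (2 * π * I * (lam' ^ 2 : ℝ) * (zScaled D z : ℂ)) *
      (Real.sqrt (π / (4 * π * (zScaled D z : ℂ).im * lam' ^ 2)) : ℂ)) =
      (cD D k * lam' * P') * (cexp (2 * π * I * (lam' ^ 2 : ℝ) * (zScaled D z : ℂ)) *
      (Real.sqrt (π / (4 * π * (zScaled D z : ℂ).im * lam' ^ 2)) : ℂ)) := by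
    calc _ = cD D k * ((lam : ℂ) * cexp (2 * π * I * (lam' ^ 2 : ℝ) * (zScaled D z : ℂ))) * P *
          (Real.sqrt (π / (4 * π * (zScaled D z : ℂ).im * lam' ^ 2)) : ℂ) := by ring
      _ = cD D k * ((lam' : ℂ) * cexp (2 * π * I * (lam' ^ 2 : ℝ) * (zScaled D z : ℂ))) * P' *
          (Real.sqrt (π / (4 * π * (zScaled D z : ℂ).im * lam' ^ 2)) : ℂ) := hJ'
      _ = _ := by ring
  exact mul_right_cancel₀ hne this

/-- **The coefficient of an orbit in terms of ANY orbit data**: if `(λ, P)` describes the orbit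
integrals of `ω` for `D` then `coef_D(ω) = 8√D · c_D(k_ω) λ P / √Δ`. [folklore] -/
theorem orbCoef_eq_of_data (hD : Odd D) (f : CuspForm (Gamma0 64) 2)
    (ω : orbitRel.Quotient (Gamma0Plus 64) (Fin 3 → ℤ)) (hpos : 0 < intDisc ω.out)
    {lam : ℝ} {P : ℂ} (hl2 : lam ^ 2 = intDisc ω.out)
    (hJ : ∀ z : ℍ, orbitIntegral D f z ω = anisoConst D z ω.out lam * P *
      (Real.sqrt (π / (4 * π * (zScaled D z : ℂ).im * lam ^ 2)) : ℝ)) :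
    orbCoef D f ω = ((8 * Real.sqrt D : ℝ) : ℂ) * (cD D ω.out * lam * P) / (Real.sqrt (intDisc ω.out) : ℂ) := by
  rw [orbCoef, dif_pos hpos]
  set lam₀ := (exists_orbit_data f ω hpos).choose
  set P₀ := (exists_orbit_data f ω hpos).choose_spec.choose
  obtain ⟨hlam₀, hl2₀, hJ₀⟩ := (exists_orbit_data f ω hpos).choose_spec.choose_spec
  have hsq : lam₀ ^ 2 = lam ^ 2 := by rw [hl2₀, hl2]
  have hcan := cD_mul_data_eq D UpperHalfPlane.I hlam₀ hsq (hJ₀ D hD UpperHalfPlane.I) (hJ UpperHalfPlane.I)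
  have habs : abs lam₀ = Real.sqrt (intDisc ω.out) := by
    rw [← Real.sqrt_sq_eq_abs, hl2₀]
  have hsqrt_ne : (Real.sqrt (intDisc ω.out) : ℂ) ≠ 0 := by
    have : (0 : ℝ) < intDisc ω.out := by exact_mod_cast hpos
    exact Complex.ofReal_ne_zero.mpr (Real.sqrt_pos.mpr this).ne'
  rw [eq_div_iff hsqrt_ne, ← habs]
  have hl₀ : (Complex.ofReal (abs lam₀)) ≠ 0 := Complex.ofReal_ne_zero.mpr (abs_ne_zero.mpr hlam₀)
  calc cD D ω.out * ((8 * Real.sqrt D * (lam₀ / abs lam₀) : ℝ) : ℂ) * P₀ * (abs lam₀ : ℝ)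
      = ((8 * Real.sqrt D : ℝ) : ℂ) * (cD D ω.out * lam₀ * P₀) * ((lam₀ / abs lam₀ * abs lam₀ / lam₀ : ℝ) : ℂ) := by
        have hl : (lam₀ : ℂ) ≠ 0 := Complex.ofReal_ne_zero.mpr hlam₀
        push_cast; field_simp
    _ = ((8 * Real.sqrt D : ℝ) : ℂ) * (cD D ω.out * lam₀ * P₀) := by
        rw [show (lam₀ / abs lam₀ * abs lam₀ / lam₀ : ℝ) = 1 by
          field_simp [abs_ne_zero.mpr hlam₀]
          exact div_self (mul_ne_zero hlam₀ (abs_ne_zero.mpr hlam₀))]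
        simp
    _ = ((8 * Real.sqrt D : ℝ) : ℂ) * (cD D ω.out * lam * P) := by rw [hcan]

end Literature.NumberTheory.EllipticCurves.Shintani
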